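import Summits.CriticalPhenomena.PercolationContinuityZ3.Theorems.Transplant.TwoAxisExitFrameSidesU
import Summits.CriticalPhenomena.PercolationContinuityZ3.Theorems.Transplant.TwoAxisParaCellsFineFrameComp
import Summits.CriticalPhenomena.PercolationContinuityZ3.Theorems.Transplant.SkelPhiKitsAStepIV
import Summits.CriticalPhenomena.PercolationContinuityZ3.Theorems.Transplant.SkelPhiQStepsN
import Summits.CriticalPhenomena.PercolationContinuityZ3.Theorems.Transplant.SkelPhiFaceRunN
import HarnessLib

/-!
# N1 ({±1} node), (F) column, kit adapter (hp-8 g33): **THE KIT CLAUSE OF A FACE-FRAME WINDOW LEVEL** — p1-g11's `kitClauseA'` (N-K5b) at the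
# face frame `ψ := pr.frame φ t I b` (twin of p1's `kitClause_runX`, N-K6d, for the run frame): quasi-steps `qSteps_frame` (cost `3`), `lip_frame`,
# the affine side forms `FinePrm.sideFormsU_frame` (slope `D`, climbing coefficients `climC`), compatibility `FinePrm.frame_comp`, the seven
# placement hypotheses from the four placement numbers (`SkelPhiAffinePlacement`, ratio `D ≤ 3·n_F`, `n_F ≤ c_I·|A|·|lvGen I b|`); the exit pieces
# `Pex` and the three per-contact Step-IV inputs stay hypotheses (the face step's route datum (h3) is a CHAIN — part (F-R), not one link)

builds on p205010 (kernel theorem, internal audit signed; external expert review pending) — nothing in this file uses p205010; nothing here is a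
claim about the open node `SamePDropOfSkeletonNeg`.
Lane `prim-bschramm`, seat `prim-hp-8` (gen 33); helper file (`--supports stmt-CriticalPhenomena-4575 --as helper`).
* **`kitClause_frame`**.
[cite: KozmaNitzan2024, §4 Lemma 10, Steps III–IV (pp. 19–21)] [cite: MartineauTassion2017, §4.3]
-/

noncomputable section

open scoped Classical

namespace Summit.CriticalPhenomena.PercolationContinuityZ3.Theorems.Transplant

namespace Skelφ

open MeasureTheory
open Literature.Probability.Percolation Literature.Probability.LatticeModels SimpleGraph KNLevels
open Literature.Barriers.CriticalPhenomena (graphBall graphBall_finite mem_graphBall_self graphBall_mono)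
open Skel (winGraph winGraph_adj winGraph_le KitGeom)
open SkelI (tanOff tanTgt tanTgt_mem)
open Literature.Probability.Percolation.KozmaNitzan.Cells (oth oth_ne eq_oth_of_ne oth_oth)

variable {V : Type} [DecidableEq V] {G : SimpleGraph V} [G.LocallyFinite] {φ : V → Site 2}

/-- `c_I·|A|·|lvGen I b| ≤ c_I·L_I` (one generator component against the `ℓ¹` norm). [folklore] -/
theorem FinePrm.cOf_abs_lvGen_le (pr : FinePrm) (I b : Fin 2) (hc : 0 ≤ pr.cOf I) : pr.cOf I * |pr.A| * |pr.lvGen I b| ≤ pr.cOf I * pr.L I := by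
  have hgen : |pr.A| * |pr.lvGen I b| ≤ pr.L I := by
    unfold FinePrm.L
    have h0 := abs_nonneg (pr.lvGen I 0)
    have h1 := abs_nonneg (pr.lvGen I 1)
    have hA := abs_nonneg pr.A
    obtain rfl | rfl : b = 0 ∨ b = 1 := by fin_cases b <;> simp
    · nlinarith
    · nlinarith
  calc pr.cOf I * |pr.A| * |pr.lvGen I b| = pr.cOf I * (|pr.A| * |pr.lvGen I b|) := by ring
    _ ≤ pr.cOf I * pr.L I := mul_le_mul_of_nonneg_left hgen hc

/-- **THE KIT CLAUSE OF A FACE-FRAME WINDOW LEVEL.**  Level box `[lo − j, hi + j]` of the frame `pr.frame φ t I b` around `w₀` (radius `R`); the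
lattice rooms `0 ≤ c_i`, `c_i·L_i ≤ D`, `0 < c_I`, `A ≠ 0`, raw axis of record (`|lvGen I (oth b)| ≤ |lvGen I b| ≠ 0`), the ratio number `n_F` with
`n_F ≤ c_I·|A|·|lvGen I b|` and `D ≤ 3·n_F`; kit constants `P` (`3 ≤ P.N`, `P.A = (nz+1)·D + 1`, the four placement numbers); short region `Rg`,
zone family `Λc`, exit pieces `Pex` with the exit inequality against the frame's side forms; per contact: far ⇒ inner neighbour in the target;
near ⇒ a face vertex in the target, or the zone estimate, the exit-link estimate and the route datum (h3) at the kit centre.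
[cite: KozmaNitzan2024, §4 Lemma 10, Steps III–IV] -/
theorem kitClause_frame [Countable V] {types : Finset V} (hlipφ : Lip G φ) (hstep : Steps G φ) (hfr : Frames G φ types)
    (hκ : CylConn G φ types) {Δ : ℕ} (hΔ : ∀ v, G.degree v ≤ Δ) {q : unitInterval} {δ : ℝ} (hδ : 0 < δ)
    -- the face frame
    (pr : FinePrm) (t : V) (I b : Fin 2) (hc₀ : 0 ≤ pr.c₀) (hc₁ : 0 ≤ pr.c₁) (hD : 0 < pr.D) (hL0 : pr.c₀ * pr.L 0 ≤ pr.D)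
    (hL1 : pr.c₁ * pr.L 1 ≤ pr.D) (hc : 0 < pr.cOf I) (hA0 : pr.A ≠ 0) (hb : |pr.lvGen I (oth b)| ≤ |pr.lvGen I b|)
    (hnz : pr.lvGen I b ≠ 0) {nF : ℕ} (hnC : (nF : ℤ) ≤ pr.cOf I * |pr.A| * |pr.lvGen I b|) (hU3 : pr.D ≤ 3 * (nF : ℤ))
    -- the level box and the window
    {lo hi : Site 2} {j : ℕ} {w₀ : V} {R : ℕ}
    -- kit constants
    (P : ApronPrm) {nz Rs Kmax KCmax rs cS cU : ℕ} (hPN : 3 ≤ P.N) (hA : P.A = (nz + 1 : ℕ) * pr.D + 1)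
    (hd1 : P.W + P.ℓ ≤ P.d) (hD1 : P.W + P.ℓ + P.d + 2 ≤ shellD P) (hD2 : P.ℓ + Rs + P.d + 3 ≤ shellD P) (hDρ : Rs + 1 ≤ shellD P)
    (hℓ : 1 ≤ P.ℓ) (hW : Rs + P.ℓ ≤ P.W) (hKmax : (shellD P + P.W) * 3 ≤ Kmax) (hKCmax : (shellD P + nz + 1) * 3 ≤ KCmax)
    (hR' : cylRadMax G φ types P.ℓ (Rs + KCmax + (P.W + Kmax)) ≤ P.R')
    (hwide : ∀ i, (lo - (j : Site 2)) i + 2 * tanOff P.ℓs P.M ≤ (hi + (j : Site 2)) i)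
    (hdw : ∀ i, (lo - (j : Site 2)) i + (P.d + 2 : ℕ) ≤ (hi + (j : Site 2)) i)
    (hDw : ∀ i, (lo - (j : Site 2)) i + ((shellD P + 1 + P.d + KCmax + Rs : ℕ) : ℤ) ≤ (hi + (j : Site 2)) i)
    (hT : (P.W : ℤ) + Kmax + P.ℓ + 1 ≤ tanOff P.ℓs P.M) (hT' : (shellD P : ℤ) + KCmax + Rs ≤ tanOff P.ℓs P.M)
    (hr₀ : P.N * (tanOff P.ℓs P.M + 2) + P.N * P.d + (P.W + Kmax + P.R') + (KCmax + Rs) ≤ P.r₀) (hR : P.r₀ ≤ R)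
    (hrs : 2 * (1 + P.N * (tanOff P.ℓs P.M + 2) + P.N * P.d + (P.W + Kmax + P.R') + (KCmax + Rs)) ≤ rs)
    (hcS : (P.N + 1) * (tanOff P.ℓs P.M + 1) + (P.N + 1) * P.d + (2 * P.W + 1) * (Kmax + 1) * (Δ + 1) ^ P.R' ≤ cS)
    -- the short region, the zone family, the exit pieces against the frame's side forms
    (Rg : V → Finset V) (hRg : ∀ c, ∀ u ∈ Rg c, u ∈ graphBall G c Rs) (hRgcard : ∀ c, (Rg c).card ≤ cU) (hcU1 : 1 ≤ cU)
    (Λc : V → ℕ → Finset V) (kz : ℕ) (hkn : ∀ c, Λc c kz ⊆ Λc c nz) (hΛ : ∀ c, ∀ v ∈ Λc c nz, v ∈ Rg c ∧ φ v - φ c ∈ box 2 nz)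
    (Pex : Fin 2 → ℤˣ → V → Finset V)
    (hPex : ∀ (i : Fin 2) (σ₀ : ℤˣ) (c : V), ∀ v ∈ Pex i σ₀ c, v ∈ Rg c ∧
      (pr.sideFormsU_frame φ t I b hc hA0 hnz hD (lo - (j : Site 2)) (hi + (j : Site 2)) i σ₀).lin (φ v) + P.A + pr.climC I b i ≤
        (pr.sideFormsU_frame φ t I b hc hA0 hnz hD (lo - (j : Site 2)) (hi + (j : Site 2)) i σ₀).lin (φ c))
    -- the level's source/support, the weighting, the region and the target
    (k : ℕ) (o : V) (Sfin : Finset V) {Wt : Sym2 V → unitInterval} {D T : Finset V} (hWD : IsSubbox (winGraph G w₀ R) Wt q D)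
    (hXD : winLevel G (pr.frame φ t I b) w₀ R lo hi j ⊆ D) {N : ℕ} (hN : k * (Δ + 1) ^ (2 * rs) ≤ N)
    (hk : (1 - (q : ℝ) ^ (1 + Δ * cS + cS * cU)) ^ k ≤ δ)
    -- per contact
    (hfar : ∀ x ∈ outerBoundary (winGraph G w₀ R) (winLevel G (pr.frame φ t I b) w₀ R lo hi j),
      ¬ IsNear G (pr.frame φ t I b) (lo - (j : Site 2)) (hi + (j : Site 2)) P w₀ R x →
      ctY G (pr.frame φ t I b) w₀ R (lo - (j : Site 2)) (hi + (j : Site 2)) x ∈ T)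
    (hnear' : ∀ x ∈ outerBoundary (winGraph G w₀ R) (winLevel G (pr.frame φ t I b) w₀ R lo hi j),
      IsNear G (pr.frame φ t I b) (lo - (j : Site 2)) (hi + (j : Site 2)) P w₀ R x →
      (∃ u ∈ ctFace G (pr.sideFormsU_frame φ t I b hc hA0 hnz hD (lo - (j : Site 2)) (hi + (j : Site 2))) Rg P w₀ R x, u ∈ T) ∨
      (1 - δ ^ 2 < (bondPercolation G q).real
          (UniqZone.zone G (Λc (ctCtr G (pr.sideFormsU_frame φ t I b hc hA0 hnz hD (lo - (j : Site 2)) (hi + (j : Site 2))) P w₀ R x)) kz nz) ∧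
        1 - δ ^ 2 < (bondPercolation G q).real
          (linkIn (↑(Rg (ctCtr G (pr.sideFormsU_frame φ t I b hc hA0 hnz hD (lo - (j : Site 2)) (hi + (j : Site 2))) P w₀ R x)) : Set V)
            (Λc (ctCtr G (pr.sideFormsU_frame φ t I b hc hA0 hnz hD (lo - (j : Site 2)) (hi + (j : Site 2))) P w₀ R x) kz)
            (Pex (ctDir G (pr.frame φ t I b) w₀ R (lo - (j : Site 2)) (hi + (j : Site 2)) x).1
              (ctDir G (pr.frame φ t I b) w₀ R (lo - (j : Site 2)) (hi + (j : Site 2)) x).2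
              (ctCtr G (pr.sideFormsU_frame φ t I b hc hA0 hnz hD (lo - (j : Site 2)) (hi + (j : Site 2))) P w₀ R x))) ∧
        ∃ Qt Ft : Finset V, Ft ⊆ T ∧ Qt ⊆ D ∧
          Disjoint Ft (Λc (ctCtr G (pr.sideFormsU_frame φ t I b hc hA0 hnz hD (lo - (j : Site 2)) (hi + (j : Site 2))) P w₀ R x) nz) ∧
          1 - δ ^ 2 < (prodBernoulli Wt).real (linkIn (↑Qt : Set V)
            (Λc (ctCtr G (pr.sideFormsU_frame φ t I b hc hA0 hnz hD (lo - (j : Site 2)) (hi + (j : Site 2))) P w₀ R x) kz) Ft))) :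
    ∃ (σ' : SData V) (S : Finset V), SHyp (winLData G (pr.frame φ t I b) w₀ R lo hi o Sfin) j σ' ∧ σ'.N ≤ N ∧
      (1 - (q : ℝ) ^ σ'.sB) ^ σ'.k ≤ δ ∧ S ⊆ (winLData G (pr.frame φ t I b) w₀ R lo hi o Sfin).X j ∧ S ⊆ D ∧
      (∀ x ∈ σ'.K, ∀ e ∈ σ'.seed x, e ∉ wireSet (↑S : Set V)) ∧ (∀ x ∈ σ'.K, σ'.face x ⊆ S) ∧
      (∀ x ∈ σ'.K, 1 - 3 * δ ≤ (prodBernoulli Wt).real {ω | ∃ u ∈ σ'.face x,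
        1 - δ < (prodBernoulli (pinW Wt (wireSet (↑S : Set V)) ω)).real (⋃ t ∈ T, openConnIn (↑D : Set V) u t)}) := by
  set SF := pr.sideFormsU_frame φ t I b hc hA0 hnz hD (lo - (j : Site 2)) (hi + (j : Site 2)) with hSF
  have hLI : pr.cOf I * pr.L I ≤ pr.D := pr.cOf_mul_L_le hL0 hL1 I
  have hU1 : (1 : ℤ) ≤ pr.D := hD
  have hnF1 : 1 ≤ nF := by
    have h3 : (0 : ℤ) < 3 * (nF : ℤ) := lt_of_lt_of_le hD hU3
    omega
  have hnD : (nF : ℤ) ≤ pr.D := hnC.trans ((pr.cOf_abs_lvGen_le I b hc.le).trans hLI)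
  have hU : pr.D ≤ ((2 + 1 : ℕ) : ℤ) * nF := by
    have e : ((2 + 1 : ℕ) : ℤ) * nF = 3 * (nF : ℤ) := by push_cast; ring
    rw [e]; exact hU3
  have haff : ∀ (i : Fin 2) (σ₀ : ℤˣ), (SF i σ₀).IsAffine pr.D (pr.climC I b i) := fun i σ₀ => by
    rw [hSF]; exact pr.sideFormsU_frame_isAffine φ t I b hc hA0 hnz hD hLI _ _ i σ₀
  have hC : ∀ (i : Fin 2) (σ₀ : ℤˣ), (nF : ℤ) ≤ pr.climC I b i := fun i σ₀ => by
    unfold FinePrm.climC; split_ifs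
    · exact hnC
    · exact hnD
  have hA1 : 0 ≤ P.A := by rw [hA]; positivity
  have hdD : P.d + 2 ≤ shellD P := le_trans (by omega) hD1
  have hU3' : pr.D ≤ 3 * (pr.cOf I * |pr.A| * |pr.lvGen I b|) := hU3.trans (by linarith only [hnC])
  have hq : QStepsN G (pr.frame φ t I b) P.N := (qStepsN_of_qSteps (pr.qSteps_frame hstep t I b hc hA0 hD hLI hb hnz hU3')).mono hPN
  have hKmax' : (shellD P + P.W) * (2 + 1) ≤ Kmax := hKmax
  have hKCmax' : (shellD P + nz + 1) * (2 + 1) ≤ KCmax := hKCmax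
  exact kitClauseA' SF Rg (pr.lip_frame hlipφ t I b hc.le hD hLI) hq hlipφ hstep hfr hκ hΔ hδ hℓ hwide hdw hdD hDw hDρ
    (hbelow_of_affine SF haff hU1 P hD1) (habove_of_affine SF haff hU1 P hd1) (hK_of_affine SF haff hU1 P hnF1 hC hU hKmax')
    (fun i σ₀ z hz _ => hKC_of_affine SF haff hU1 P hnF1 hC hU hA hKCmax' i σ₀ z hz) (hθA_of_affine SF haff hU1 P hA1 hdD)
    (hAz_of_affine SF haff P hA) (hcap_of_affine SF haff hU1 P hD2) (pr.frame_comp t hc₀ hc₁ hD hL0 hL1 I b) hT hT' hW hR' hRg hRgcard hcU1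
    hr₀ hR hrs hcS Λc hkn hΛ Pex (fun i σ₀ c v hv => ⟨(hPex i σ₀ c v hv).1, by rw [(haff i σ₀).clim_eq]; exact (hPex i σ₀ c v hv).2⟩)
    k o Sfin hWD hXD hN hk hfar hnear'

end Skelφ

end Summit.CriticalPhenomena.PercolationContinuityZ3.Theorems.Transplant

end
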